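import Summits.NavierStokesRegularity.NavierStokesRegularity.Theses.PlaneEnergyCeiling
import Summits.NavierStokesRegularity.NavierStokesRegularity.Theorems.PlaneEnergyCeilingBoundedPlanarEnergyRegularityLocalClayTheory

/-!
# Route PlaneEnergyCeiling · crux `BoundedPlanarEnergyRegularity` — glue through the landed
# per-datum local Clay theory

Helper file for the crux item stmt-NavierStokesRegularity-16921 (`BoundedPlanarEnergyRegularity`).
With the stub `stub_localClayTheory` landed
(`Theorems/PlaneEnergyCeilingBoundedPlanarEnergyRegularityLocalClayTheory.lean`), the two
formulations of the velocity-record zoom and the birth composition of the crux become one-step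
consequences (pure logic over the route decls):

* `planarEnergyZoomA_of_planarEnergyZoom` — the extension-form zoom `PlanarEnergyZoom`
  (support item stmt-NavierStokesRegularity-16858) implies the Clay-(A)-form zoom
  `PlanarEnergyZoomA` (crux stmt-NavierStokesRegularity-16915, a hypothesis of the route's deciding
  theorem `closes`): if (A) fails for `u₀`, the local Clay theory yields a classical Leray–Hopf
  solution from `u 0 = u₀` with no smooth extension past some `T`, the planar hypothesis bounds its
  planar energies on `[0,T)`, and the extension-form zoom delivers the ancient solution.
* `boundedPlanarEnergyRegularity_of_liouville_zoom` — `PlanarEnergyLiouville → PlanarEnergyZoom →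
  BoundedPlanarEnergyRegularity`: the birth composition
  (`Cruxes/BoundedPlanarEnergyRegularity/Lines/birth.lean`, `BoundedPlanarEnergyRegularity_of_stubs`)
  with its first stub discharged, i.e. the crux reduced to the two items stmt-16856 (Liouville in
  the planar-energy class, open) and stmt-16858 (extension-form zoom).

References: KNSS 2009 (Prop. 6.1); Lemarié-Rieusset 2016 (Thm. 15.1, Prop. 12.3).
-/

noncomputable section

-- single-conjunct summit: `Summit.<Summit>.<Problem>` repeats the name by the D-0017 layout
set_option linter.dupNamespace false

namespace Summit.NavierStokesRegularity.NavierStokesRegularity.Theorems.BoundedPlanarEnergyRegularity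

open Summit.NavierStokesRegularity.NavierStokesRegularity.Theses.PlaneEnergyCeiling

/-- **Extension-form zoom ⇒ (A)-form zoom.** `PlanarEnergyZoom → PlanarEnergyZoomA`: under the
planar hypothesis for the datum `u₀`, if Clay (A) fails for `u₀` then (contrapositive of the landed
per-datum local Clay theory `stub_localClayTheory`) some classical Leray–Hopf `(u,p)` on `[0,T)` with
`u 0 = u₀` has no smooth extension past `T`; its planar energies are bounded on `[0,T)` by the
hypothesis, and `PlanarEnergyZoom` produces the non-zero bounded ancient mild solution with bounded
planar energies. -/
theorem planarEnergyZoomA_of_planarEnergyZoom :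
    Summit.NavierStokesRegularity.NavierStokesRegularity.Theses.PlaneEnergyCeiling.PlanarEnergyZoom →
      Summit.NavierStokesRegularity.NavierStokesRegularity.Theses.PlaneEnergyCeiling.PlanarEnergyZoomA := by
  intro hZ ν hν u₀ hu₀ hdiv hdec hpl hA
  have hex : ¬ ∀ (T : ℝ), 0 < T →
      ∀ (u : ℝ → EuclideanSpace ℝ (Fin 3) → EuclideanSpace ℝ (Fin 3))
        (p : ℝ → EuclideanSpace ℝ (Fin 3) → ℝ),
        Literature.Analysis.FluidPDE.IsClassicalNSSolutionOn (Set.Ico 0 T) ν 0 u p →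
        Literature.Analysis.FluidPDE.IsLerayHopfOn T ν 0 (u 0) u → u 0 = u₀ →
        Literature.Analysis.FluidPDE.HasSmoothExtensionPast ν 0 u T := fun hall =>
    hA (PlaneEnergyCeilingBoundedPlanarEnergyRegularity.stub_localClayTheory ν hν u₀ hu₀ hdiv hdec hall)
  push Not at hex
  obtain ⟨T, hT, u, p, hcl, hLH, h0, hne⟩ := hex
  obtain ⟨M, hM⟩ := hpl T hT u p hcl hLH h0
  exact hZ ν T hν hT u p hcl hLH (h0 ▸ hdec) hne ⟨M, hM⟩

/-- **The crux from Liouville and the extension-form zoom** (birth composition with the local Clay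
theory discharged): `PlanarEnergyLiouville → PlanarEnergyZoom → BoundedPlanarEnergyRegularity`.
Feed `stub_localClayTheory`; to continue an arbitrary classical Leray–Hopf `(u,p)` from `u 0 = u₀`
past `T`, argue by contradiction: the planar hypothesis bounds the planar energies of this solution
on `[0,T)`, the zoom gives a non-zero bounded ancient mild solution with bounded planar energies,
and the Liouville theorem kills it. -/
theorem boundedPlanarEnergyRegularity_of_liouville_zoom :
    Summit.NavierStokesRegularity.NavierStokesRegularity.Theses.PlaneEnergyCeiling.PlanarEnergyLiouville →
      Summit.NavierStokesRegularity.NavierStokesRegularity.Theses.PlaneEnergyCeiling.PlanarEnergyZoom →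
        Summit.NavierStokesRegularity.NavierStokesRegularity.Theses.PlaneEnergyCeiling.BoundedPlanarEnergyRegularity := by
  intro hL hZ ν hν u₀ hu₀ hdiv hdec hpl
  refine PlaneEnergyCeilingBoundedPlanarEnergyRegularity.stub_localClayTheory ν hν u₀ hu₀ hdiv hdec ?_
  intro T hT u p hcl hLH h0
  by_contra hne
  obtain ⟨M, hM⟩ := hpl T hT u p hcl hLH h0
  obtain ⟨v, M', hv, hmeas, hsm, hpb, t, ht, x, hx⟩ :=
    hZ ν T hν hT u p hcl hLH (h0 ▸ hdec) hne ⟨M, hM⟩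
  exact hx (hL v hv hmeas hsm ⟨M', hpb⟩ t ht x)

end Summit.NavierStokesRegularity.NavierStokesRegularity.Theorems.BoundedPlanarEnergyRegularity

end
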